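import Literature.AlgebraicGeometry.Motives.CurveDiagonalDivisor
import Literature.AlgebraicGeometry.Motives.RationalPointOfBaseChange
import HarnessLib

/-!
# The fibres of the diagonal divisor: `Δ|_{C × {Q}} = [Q]` with multiplicity one
# (Milne, *Jacobian Varieties*, §3 Example 3.12)

Let `C / K` be a smooth proper geometrically integral curve, `Δ ⊂ C × C` its diagonal divisor
(`Motives/CurveDiagonalDivisor`), `π : Spec L → Spec K` a field-valued point of the base and
`Q : Spec L → C` an `L`-valued point. The fibre `C × {Q}` is the curve `C_L = C ×_K Spec L`
(`curveBC C π : SchemeOver L`, smooth proper integral) embedded by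
`fibreIncl = C ◁ Q : C_L → C ×_K C`, and carries the `L`-rational point `pt = (Q, 𝟙)`
(`FieldPoint.ratPtPoint`, `Motives/RationalPointOfBaseChange`). This file proves that **the
restriction of `Δ` to the fibre is the prime divisor of the rational point, with multiplicity one**
— Milne's Example 3.12 ("`D = Σ sᵢ(Cʳ)` … whose fibre over `(P₁, …, P_r)` is `Σ Pᵢ`") for one factor,
valid at all points including those with inseparable residue field, where the naive local equation
`t ⊗ 1 − 1 ⊗ t` fails:

* `diffFn C a = pr₁^♯ a − pr₂^♯ a`, `pullbackFn_diag_diffFn` (`= 0` along the diagonal),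
  `not_isUnitAt_diffFn_diag`;
* `ComplementDivisor.Chart.isRegularAt_div_fn` — **a function vanishing on the support near `z` is
  divisible by the radical local equation** of a chart of `divisorOfPure` (`h ∈ ⋂_{𝔭 ∋ g} 𝔭 = √(g)`
  in `𝒪_{X,z}`, read on an affine chart: Mathlib `Ideal.radical_eq_sInf`,
  `IsLocalization.AtPrime`, the tree's `RatFnAffine`);
* `curveBC`, `fibreIncl`, `fibreIncl_pr₁`, `fibreIncl_pr₂`, `ratPt_fibreIncl`
  (`(Q, 𝟙) ≫ fibreIncl = Q ≫ diag`), `fibreIncl_eq_diagPt` (a point of the fibre on `Δ` lies over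
  `z_Q = (c_Q, c_Q)`), `isRegularAt_diffFn_div` (`h_a / g ∈ 𝒪_{z_Q}`);
* **`pullbackFn_fibreIncl_diffFn`** — the key identity `fibreIncl^*(h_a) = k_a = pr^♯ a − a(Q)`
  (`FieldPoint.kFun`), through `pullbackFn_Q_ofSection` (pull-back along `Q` is the constant `a(Q)`,
  Mathlib `stalkClosedPointIso`) and `pullbackFn_str_const`;
* **`eq_ratPtPoint_of_fibreIncl_mem`** — the only point of the fibre on `Δ` is `pt` (off `pt` some
  `k_a` is a unit, `FieldPoint.exists_isUnit_germ_kFun`, while `k_a = fibreIncl^*(h_a/g) · fibreIncl^*g`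
  with `g(z_Q) = 0`); `ratPtPoint_ne_genericPoint`, `avoids_fibreIncl_genericPoint`;
* `diagonalFibre C π Q := Δ.pullbackAvoiding fibreIncl` and **`ord_pullbackFn_fn_ratPtPoint`**:
  the pulled-back local equation has order ONE at `pt` (its germ divides all germs of the `k_a`,
  which generate `𝔪_{pt}` by `FieldPoint.span_germ_kFun_eq_maximalIdeal`, so it is a uniformizer,
  Mathlib `IsDiscreteValuationRing.irreducible_of_span_eq_maximalIdeal`);
* **`ordAt_diagonalFibre : ord_y(Δ|_{C×{Q}}) = δ_{y,pt}`**, `ordAt_diagonalFibre_eq_ordAt_pointDivisor`,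
  **`toDivisor_diagonalFibre = place(pt)`**, `isEffective_diagonalFibre`,
  `diagonalFibre_linEquiv_classPullback` (the divisor-class pullback of `Δ` to the fibre is `∼ [pt]`).

Everything is proved; no named facts (D-0026). Step (β2) of the construction of the Jacobian
(`nonempty_jacobian_of_isSmoothProjective`): the fibres of the universal divisor on `C × Cᵍ`.

Mathlib searched (pin): `Scheme.stalkClosedPointTo`, `stalkClosedPointIso`,
`ΓSpecIso_hom_stalkClosedPointIso_inv`, `genericPoint_eq_of_isDominant`, `Ideal.radical_eq_sInf`,
`IsLocalization.AtPrime.isUnit_to_map_iff`, `Ideal.mem_span_singleton'`,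
`IsDiscreteValuationRing.irreducible_of_span_eq_maximalIdeal`, `IsDiscreteValuationRing.addVal_uniformizer`,
`Order.height_eq_zero`, `not_isMin_iff` (all used).

## References

* J. S. Milne, *Jacobian Varieties*, in: Arithmetic Geometry (Cornell–Silverman, eds.), Springer
  1986, §3 Example 3.12 (p. 246 of the volume). [Milne1986JacobianVarieties]
* U. Görtz, T. Wedhorn, *Algebraic Geometry I* (2nd ed., 2020), (4.11), (11.16) Def. 11.49
  (pull-back of Cartier divisors). [GortzWedhorn2020]
-/

noncomputable section

open CategoryTheory CategoryTheory.Limits AlgebraicGeometry IsLocalRing Order TopologicalSpace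
  MonoidalCategory CartesianMonoidalCategory

universe u

namespace Literature.AlgebraicGeometry.Motives

namespace CurvePlaces

open RatFn

variable {K : Type u} [Field K]

section DiffFn

variable (C : SchemeOver K) [IsIntegral C.left] [SmoothOfRelativeDimension 1 C.hom] [IsProper C.hom]
  [GeometricallyIntegral C.hom]

/-- The first projection `C × C → C`. [folklore] -/
abbrev pr₁ : (C ⊗ C).left ⟶ C.left := (fst C C).left

/-- The second projection `C × C → C`. [folklore] -/
abbrev pr₂ : (C ⊗ C).left ⟶ C.left := (snd C C).left

omit [SmoothOfRelativeDimension 1 C.hom] [IsProper C.hom] [GeometricallyIntegral C.hom] in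
/-- `C → Spec K` is surjective. [folklore] -/
instance surjective_hom : Surjective C.hom :=
  ⟨Function.surjective_to_subsingleton (α := C.left) (β := Spec (.of K)) _⟩

/-- The projections are surjective (base change of the surjective `C → Spec K`). [folklore] -/
instance surjective_pr₁ : Surjective (pr₁ C) :=
  MorphismProperty.pullback_fst (P := @Surjective) _ _ inferInstance

/-- The projections are surjective. [folklore] -/
instance surjective_pr₂ : Surjective (pr₂ C) :=
  MorphismProperty.pullback_snd (P := @Surjective) _ _ inferInstance

omit [IsIntegral C.left] [SmoothOfRelativeDimension 1 C.hom] [IsProper C.hom] [GeometricallyIntegral C.hom] in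
/-- `diag ≫ pr₁ = 𝟙`. [folklore] -/
@[reassoc (attr := simp)]
theorem diag_left_pr₁ : (diag C).left ≫ pr₁ C = 𝟙 _ := by
  change (lift (𝟙 C) (𝟙 C) ≫ fst C C).left = _
  rw [lift_fst]; rfl

omit [IsIntegral C.left] [SmoothOfRelativeDimension 1 C.hom] [IsProper C.hom] [GeometricallyIntegral C.hom] in
/-- `diag ≫ pr₂ = 𝟙`. [folklore] -/
@[reassoc (attr := simp)]
theorem diag_left_pr₂ : (diag C).left ≫ pr₂ C = 𝟙 _ := by
  change (lift (𝟙 C) (𝟙 C) ≫ snd C C).left = _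
  rw [lift_snd]; rfl

omit [IsIntegral C.left] [SmoothOfRelativeDimension 1 C.hom] [IsProper C.hom] [GeometricallyIntegral C.hom] in
/-- `pr₁ (diag c) = c`. [folklore] -/
@[simp] theorem pr₁_diag (c : C.left) : pr₁ C ((diag C).left c) = c := by
  change ((diag C).left ≫ pr₁ C) c = c; rw [diag_left_pr₁]; rfl

omit [IsIntegral C.left] [SmoothOfRelativeDimension 1 C.hom] [IsProper C.hom] [GeometricallyIntegral C.hom] in
/-- `pr₂ (diag c) = c`. [folklore] -/
@[simp] theorem pr₂_diag (c : C.left) : pr₂ C ((diag C).left c) = c := by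
  change ((diag C).left ≫ pr₂ C) c = c; rw [diag_left_pr₂]; rfl

/-- **The functions `h_a = pr₁^♯ a − pr₂^♯ a` on `C × C`** vanishing on the diagonal. [folklore] -/
def diffFn (a : C.left.functionField) : (C ⊗ C).left.functionField :=
  functionFieldMap (pr₁ C) a - functionFieldMap (pr₂ C) a

variable {C}

/-- `h_a` is regular where `a` is regular at both projections. [folklore] -/
theorem isRegularAt_diffFn {a : C.left.functionField} {w : (C ⊗ C).left}
    (h₁ : IsRegularAt (pr₁ C w) a) (h₂ : IsRegularAt (pr₂ C w) a) : IsRegularAt w (diffFn C a) := by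
  obtain ⟨s, hs⟩ := h₁.functionFieldMap (f := pr₁ C)
  obtain ⟨t, ht⟩ := h₂.functionFieldMap (f := pr₂ C)
  exact ⟨s - t, by rw [map_sub, hs, ht]; rfl⟩

/-- `pullbackFn` of a negative. [folklore] -/
theorem _root_.Literature.AlgebraicGeometry.Motives.RatFn.pullbackFn_neg {X Y : Scheme.{u}}
    [IsIntegral X] [IsIntegral Y] (g : Y ⟶ X) {a : X.functionField}
    (ha : IsRegularAt (g (genericPoint Y)) a) : pullbackFn g (-a) = -pullbackFn g a := by
  obtain ⟨t, rfl⟩ := ha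
  rw [← map_neg, pullbackFn_toFunctionField, pullbackFn_toFunctionField, map_neg, map_neg]

/-- `pullbackFn` of a difference of functions regular at `g(η)`. [folklore] -/
theorem _root_.Literature.AlgebraicGeometry.Motives.RatFn.pullbackFn_sub {X Y : Scheme.{u}}
    [IsIntegral X] [IsIntegral Y] (g : Y ⟶ X) {a b : X.functionField}
    (ha : IsRegularAt (g (genericPoint Y)) a) (hb : IsRegularAt (g (genericPoint Y)) b) :
    pullbackFn g (a - b) = pullbackFn g a - pullbackFn g b := by
  have hb' : IsRegularAt (g (genericPoint Y)) (-b) := by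
    obtain ⟨t, ht⟩ := hb; exact ⟨-t, by rw [map_neg, ht]⟩
  rw [sub_eq_add_neg, pullbackFn_add g ha hb', pullbackFn_neg g hb, ← sub_eq_add_neg]

/-- Pulling `pr_i^♯ a` back along the diagonal gives `a`. [folklore] -/
theorem pullbackFn_diag_functionFieldMap_pr₁ (a : C.left.functionField) :
    pullbackFn (diag C).left (functionFieldMap (pr₁ C) a) = a := by
  rw [← pullbackFn_eq_functionFieldMap, ← pullbackFn_comp (pr₁ C) (diag C).left
    (by rw [pr₁_diag]; exact isRegularAt_genericPoint a), diag_left_pr₁,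
    pullbackFn_eq_functionFieldMap, functionFieldMap_id]
  rfl

/-- Pulling `pr₂^♯ a` back along the diagonal gives `a`. [folklore] -/
theorem pullbackFn_diag_functionFieldMap_pr₂ (a : C.left.functionField) :
    pullbackFn (diag C).left (functionFieldMap (pr₂ C) a) = a := by
  rw [← pullbackFn_eq_functionFieldMap, ← pullbackFn_comp (pr₂ C) (diag C).left
    (by rw [pr₂_diag]; exact isRegularAt_genericPoint a), diag_left_pr₂,
    pullbackFn_eq_functionFieldMap, functionFieldMap_id]
  rfl

/-- **`h_a` vanishes on the diagonal**: `diag^* h_a = a − a = 0`. [folklore] -/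
theorem pullbackFn_diag_diffFn (a : C.left.functionField) :
    pullbackFn (diag C).left (diffFn C a) = 0 := by
  have h₁ : IsRegularAt ((diag C).left (genericPoint C.left)) (functionFieldMap (pr₁ C) a) :=
    (show IsRegularAt (pr₁ C ((diag C).left (genericPoint C.left))) a by
      rw [pr₁_diag]; exact isRegularAt_genericPoint a).functionFieldMap
  have h₂ : IsRegularAt ((diag C).left (genericPoint C.left)) (functionFieldMap (pr₂ C) a) :=
    (show IsRegularAt (pr₂ C ((diag C).left (genericPoint C.left))) a by
      rw [pr₂_diag]; exact isRegularAt_genericPoint a).functionFieldMap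
  rw [diffFn, pullbackFn_sub _ h₁ h₂, pullbackFn_diag_functionFieldMap_pr₁,
    pullbackFn_diag_functionFieldMap_pr₂, sub_self]

omit [SmoothOfRelativeDimension 1 C.hom] [IsProper C.hom] [GeometricallyIntegral C.hom] in
/-- `0` is not a unit at any point. [folklore] -/
theorem _root_.Literature.AlgebraicGeometry.Motives.RatFn.not_isUnitAt_zero {X : Scheme.{u}}
    [IsIntegral X] (x : X) : ¬ IsUnitAt x (0 : X.functionField) := by
  rintro ⟨u, hu⟩
  exact u.ne_zero ((map_eq_zero_iff _ (toFunctionField_injective x)).mp hu)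

/-- **`h_a` is not a unit at any point of the diagonal.** [folklore] -/
theorem not_isUnitAt_diffFn_diag (a : C.left.functionField) (c : C.left) :
    ¬ IsUnitAt ((diag C).left c) (diffFn C a) := fun h ↦ by
  have := h.pullbackFn (g := (diag C).left) (y := c)
  rw [pullbackFn_diag_diffFn] at this
  exact RatFn.not_isUnitAt_zero c this

end DiffFn

/-! ### Functions vanishing on the support are divisible by a radical local equation -/

section Radical

variable {X : Scheme.{u}} [IsIntegral X] {U : X.Opens}

/-- A regular function divided by a unit is regular. [folklore] -/
theorem _root_.Literature.AlgebraicGeometry.Motives.RatFn.IsRegularAt.div_of_isUnitAt {x : X}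
    {f u : X.functionField} (hf : IsRegularAt x f) (hu : IsUnitAt x u) : IsRegularAt x (f / u) := by
  rw [div_eq_mul_inv]; exact hf.mul hu.inv.isRegularAt

/-- **A function vanishing on the support near `z` is divisible by the radical local equation**:
for a chart `c = (W, j)` of `ComplementDivisor.divisorOfPure` (local equation `g = c.fn`, a unit
exactly off `X ∖ U` and generating a radical ideal at every point of `W`) and `h ∈ 𝒪_{X,z}`,
`z ∈ W`, which is a non-unit at every generisation `w ⤳ z` lying in the support `X ∖ U`, the quotient
`h / g` is regular at `z`: `h` lies in every prime of `𝒪_{X,z}` containing `g`, i.e. in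
`rad(g 𝒪_{X,z}) = g 𝒪_{X,z}`-up-to-powers, and `g 𝒪_{X,z}` is radical. [folklore] -/
theorem _root_.Literature.AlgebraicGeometry.Motives.ComplementDivisor.Chart.isRegularAt_div_fn
    (c : ComplementDivisor.Chart U) {z : X} (hz : z ∈ c.W) {h : X.functionField}
    (hh : IsRegularAt z h)
    (hvan : ∀ w : X, w ∈ c.W → w ⤳ z → w ∉ U → ¬ IsUnitAt w h) :
    IsRegularAt z (h / c.fn) := by
  classical
  -- an affine neighbourhood `V ∋ z` inside the chart; replace `z` by a point `zV : V`
  obtain ⟨V, hV, hzV, hVW⟩ := exists_isAffineOpen_mem_and_subset (X := X) (x := z) (U := c.W) hz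
  have hVW : V ≤ c.W := hVW
  haveI : Nonempty V := ⟨⟨z, hzV⟩⟩
  obtain ⟨zV, rfl⟩ : ∃ zV : V, (zV : X) = z := ⟨⟨z, hzV⟩, rfl⟩
  haveI := hV.isLocalization_stalk zV
  -- the local equation as a section over `V`
  set g₀ : Γ(X, V) := X.presheaf.map (homOfLE hVW).op c.j with hg₀
  have hg : c.fn = algebraMap Γ(X, V) X.functionField g₀ := c.fn_eq_of_le hVW
  -- `h = s / t` with `t ∉ 𝔷`
  obtain ⟨s₀, t₀, ht₀, hst⟩ := (isRegularAt_iff_exists hV zV h).mp hh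
  have ht₀K : algebraMap Γ(X, V) X.functionField t₀ ≠ 0 := algebraMap_ne_zero_of_notMem hV ht₀
  -- `s ∈ rad(g 𝒪_z)`
  have hrad : algebraMap Γ(X, V) (X.presheaf.stalk (zV : X)) s₀ ∈
      (Ideal.span {algebraMap Γ(X, V) (X.presheaf.stalk (zV : X)) g₀}).radical := by
    rw [Ideal.radical_eq_sInf, Submodule.mem_sInf]
    rintro P ⟨hgP, hP⟩
    haveI : Ideal.IsPrime P := hP
    have hgP' : algebraMap Γ(X, V) (X.presheaf.stalk (zV : X)) g₀ ∈ P :=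
      hgP (Ideal.subset_span rfl)
    set 𝔴 : Ideal Γ(X, V) := Ideal.comap (algebraMap Γ(X, V) (X.presheaf.stalk (zV : X))) P with h𝔴
    haveI : 𝔴.IsPrime := Ideal.comap_isPrime _ P
    -- `𝔴 ≤ 𝔷`
    have h𝔴le : 𝔴 ≤ (hV.primeIdealOf zV).asIdeal := by
      intro x hx
      by_contra hxz
      have hu : IsUnit (algebraMap Γ(X, V) (X.presheaf.stalk (zV : X)) x) :=
        (IsLocalization.AtPrime.isUnit_to_map_iff (X.presheaf.stalk (zV : X))
          (hV.primeIdealOf zV).asIdeal x).2 hxz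
      exact hP.ne_top (Ideal.eq_top_of_isUnit_mem P hx hu)
    -- the point `w` of `𝔴`: a generisation of `z` in the support
    set q : PrimeSpectrum Γ(X, V) := ⟨𝔴, inferInstance⟩
    set wV : V := ⟨hV.fromSpec q, FieldNorm.fromSpec_mem hV q⟩
    have hwq : hV.primeIdealOf wV = q := FieldNorm.primeIdealOf_fromSpec hV q
    have hwz : (wV : X) ⤳ (zV : X) :=
      (Dimension.Scheme.specializes_iff_primeIdealOf_le hV wV zV).2 (by rw [hwq]; exact h𝔴le)
    have hwW : (wV : X) ∈ c.W := hVW wV.2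
    have hg₀w : g₀ ∈ (hV.primeIdealOf wV).asIdeal := by rw [hwq]; exact hgP'
    have hgw : ¬ IsUnitAt (wV : X) c.fn := by
      rw [hg, isUnitAt_algebraMap_iff hV wV]; exact not_not.2 hg₀w
    have hwU : (wV : X) ∉ U := fun hwU ↦ hgw ((c.isUnitAt_iff hwW).2 hwU)
    have hhw := hvan wV hwW hwz hwU
    -- hence `s₀ ∈ 𝔴`
    have hs₀ : s₀ ∈ (hV.primeIdealOf wV).asIdeal := by
      by_contra hs
      apply hhw
      have ht : t₀ ∉ (hV.primeIdealOf wV).asIdeal := fun ht ↦ ht₀ (by rw [hwq] at ht; exact h𝔴le ht)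
      have e : h = algebraMap Γ(X, V) X.functionField s₀ / algebraMap Γ(X, V) X.functionField t₀ := by
        rw [eq_div_iff (algebraMap_ne_zero_of_notMem hV ht), hst]
      rw [e, div_eq_mul_inv]
      exact ((isUnitAt_algebraMap_iff hV wV s₀).2 hs).mul ((isUnitAt_algebraMap_iff hV wV t₀).2 ht).inv
    rw [hwq] at hs₀
    exact hs₀
  -- `s₀ⁿ = r g₀` in `𝒪_z`
  obtain ⟨n, hn⟩ := hrad
  obtain ⟨r, hr⟩ := Ideal.mem_span_singleton'.mp hn
  -- `hⁿ / g = r / tⁿ` is regular at `z`, hence so is `h / g` (radical local equation)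
  refine c.radicalAt hz h n hh ?_
  have hg0 : c.fn ≠ 0 := c.ne_zero
  have e1 : h = algebraMap Γ(X, V) X.functionField s₀ / algebraMap Γ(X, V) X.functionField t₀ := by
    rw [eq_div_iff ht₀K, hst]
  have e2 : (algebraMap Γ(X, V) X.functionField s₀) ^ n = toFunctionField (zV : X) r * c.fn := by
    have := congrArg (toFunctionField (zV : X)) hr
    rw [map_mul, map_pow, toFunctionField_algebraMap_stalk, toFunctionField_algebraMap_stalk] at this
    rw [← this, hg]
  have e3 : h ^ n / c.fn =
      toFunctionField (zV : X) r / (algebraMap Γ(X, V) X.functionField t₀) ^ n := by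
    rw [e1, div_pow, e2]
    field_simp
  rw [e3]
  exact (show IsRegularAt (zV : X) (toFunctionField (zV : X) r) from ⟨r, rfl⟩).div_of_isUnitAt
    (((isUnitAt_algebraMap_iff hV zV t₀).2 ht₀).pow n)

end Radical

/-! ### The fibre `C × {Q}` of `C × C` over an `L`-valued point `Q` -/

section Fibre

open FieldPoint

variable (C : SchemeOver K) [IsIntegral C.left] [SmoothOfRelativeDimension 1 C.hom] [IsProper C.hom]
  [GeometricallyIntegral C.hom] {L : Type u} [Field L] (π : Spec (.of L) ⟶ Spec (.of K))
  (Q : Over.mk π ⟶ C)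

/-- **The curve `C_L = C ×_K Spec L` over `L`**. [folklore] -/
def curveBC : SchemeOver L := Over.mk (fieldPointStr C π)

omit [IsIntegral C.left] [SmoothOfRelativeDimension 1 C.hom] [IsProper C.hom] [GeometricallyIntegral C.hom] in
/-- The underlying scheme of `C_L` is `(C ⊗ Spec L).left`. [folklore] -/
@[simp] theorem curveBC_left : (curveBC C π).left = (C ⊗ Over.mk π).left := rfl

omit [IsIntegral C.left] [SmoothOfRelativeDimension 1 C.hom] [IsProper C.hom] [GeometricallyIntegral C.hom] in
/-- The structure morphism of `C_L` is the second projection. [folklore] -/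
@[simp] theorem curveBC_hom : (curveBC C π).hom = fieldPointStr C π := rfl

omit [IsIntegral C.left] [SmoothOfRelativeDimension 1 C.hom] [IsProper C.hom] in
/-- `C_L` is integral. [folklore] -/
instance isIntegral_curveBC_left : IsIntegral (curveBC C π).left := isIntegral_tensorObj_mk_left C π

omit [IsIntegral C.left] [IsProper C.hom] [GeometricallyIntegral C.hom] in
/-- `C_L → Spec L` is smooth of relative dimension one. [folklore] -/
instance smooth_curveBC : SmoothOfRelativeDimension 1 (curveBC C π).hom := by
  haveI := smoothOfRelativeDimension_isStableUnderBaseChange (n := 1)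
  exact MorphismProperty.pullback_snd (P := @SmoothOfRelativeDimension 1) _ _ inferInstance

omit [IsIntegral C.left] [SmoothOfRelativeDimension 1 C.hom] [GeometricallyIntegral C.hom] in
/-- `C_L → Spec L` is proper. [folklore] -/
instance isProper_curveBC : IsProper (curveBC C π).hom :=
  inferInstanceAs (IsProper (pullback.snd C.hom π))

/-- **The inclusion of the fibre `C × {Q} ↪ C × C`**: `C_L → C ×_K C`, `(x, *) ↦ (x, Q)`. [folklore] -/
def fibreIncl : (C ⊗ Over.mk π).left ⟶ (C ⊗ C).left := (C ◁ Q).left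

omit [IsIntegral C.left] [SmoothOfRelativeDimension 1 C.hom] [IsProper C.hom] [GeometricallyIntegral C.hom] in
/-- `fibreIncl ≫ pr₁` is the first projection `C_L → C`. [folklore] -/
@[reassoc]
theorem fibreIncl_pr₁ : fibreIncl C π Q ≫ pr₁ C = fieldPointFst C π := by
  change (C ◁ Q ≫ fst C C).left = (fst C (Over.mk π)).left
  rw [whiskerLeft_fst]

omit [IsIntegral C.left] [SmoothOfRelativeDimension 1 C.hom] [IsProper C.hom] [GeometricallyIntegral C.hom] in
/-- `fibreIncl ≫ pr₂` is the constant map through `Q`. [folklore] -/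
@[reassoc]
theorem fibreIncl_pr₂ : fibreIncl C π Q ≫ pr₂ C = fieldPointStr C π ≫ Q.left := by
  change (C ◁ Q ≫ snd C C).left = (snd C (Over.mk π) ≫ Q).left
  rw [whiskerLeft_snd]

/-- The image point `c_Q ∈ C` of `Q`. [folklore] -/
abbrev imagePt : C.left := Q.left (closedPoint L)

/-- The diagonal point `z_Q = (c_Q, c_Q)`. [folklore] -/
abbrev diagPt : (C ⊗ C).left := (diag C).left (imagePt C π Q)

omit [IsIntegral C.left] [SmoothOfRelativeDimension 1 C.hom] [IsProper C.hom] [GeometricallyIntegral C.hom] in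
/-- The rational point of `C_L` maps to the diagonal point: `(Q, 𝟙) ≫ fibreIncl = Q ≫ diag`. [folklore] -/
theorem ratPt_fibreIncl : ratPt C π Q ≫ fibreIncl C π Q = Q.left ≫ (diag C).left := by
  apply pullback.hom_ext
  · change (ratPt C π Q ≫ fibreIncl C π Q) ≫ pr₁ C = (Q.left ≫ (diag C).left) ≫ pr₁ C
    rw [Category.assoc, fibreIncl_pr₁, ratPt_fst, Category.assoc, diag_left_pr₁, Category.comp_id]
  · change (ratPt C π Q ≫ fibreIncl C π Q) ≫ pr₂ C = (Q.left ≫ (diag C).left) ≫ pr₂ C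
    rw [Category.assoc, fibreIncl_pr₂, ratPt_snd_assoc, Category.assoc, diag_left_pr₂,
      Category.comp_id]

omit [IsIntegral C.left] [SmoothOfRelativeDimension 1 C.hom] [IsProper C.hom] [GeometricallyIntegral C.hom] in
/-- `fibreIncl (pt) = z_Q`. [folklore] -/
theorem fibreIncl_ratPtPoint : fibreIncl C π Q (ratPtPoint C π Q) = diagPt C π Q := by
  have h := congrArg (fun f : Spec (.of L) ⟶ (C ⊗ C).left ↦ f (closedPoint L)) (ratPt_fibreIncl C π Q)
  exact h

omit [IsIntegral C.left] [SmoothOfRelativeDimension 1 C.hom] [IsProper C.hom] [GeometricallyIntegral C.hom] in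
/-- Every point of the fibre lies over `c_Q` under the second projection. [folklore] -/
theorem pr₂_fibreIncl (y : (C ⊗ Over.mk π).left) : pr₂ C (fibreIncl C π Q y) = imagePt C π Q := by
  have h := congrArg (fun f : (C ⊗ Over.mk π).left ⟶ C.left ↦ f y) (fibreIncl_pr₂ C π Q)
  change pr₂ C (fibreIncl C π Q y) = Q.left (fieldPointStr C π y) at h
  rw [h, Subsingleton.elim (fieldPointStr C π y) (closedPoint L)]

omit [IsIntegral C.left] [SmoothOfRelativeDimension 1 C.hom] [IsProper C.hom] [GeometricallyIntegral C.hom] in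
/-- Every point of the fibre lies over the first coordinate under the first projection. [folklore] -/
theorem pr₁_fibreIncl (y : (C ⊗ Over.mk π).left) : pr₁ C (fibreIncl C π Q y) = fieldPointFst C π y := by
  have h := congrArg (fun f : (C ⊗ Over.mk π).left ⟶ C.left ↦ f y) (fibreIncl_pr₁ C π Q)
  exact h

omit [IsIntegral C.left] [SmoothOfRelativeDimension 1 C.hom] [IsProper C.hom] [GeometricallyIntegral C.hom] in
/-- **A point of the fibre on the diagonal is over `z_Q`**: if `fibreIncl y ∈ Δ` then
`fibreIncl y = (c_Q, c_Q)`. [folklore] -/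
theorem fibreIncl_eq_diagPt {y : (C ⊗ Over.mk π).left} (hy : fibreIncl C π Q y ∈ diagonalSet C) :
    fibreIncl C π Q y = diagPt C π Q := by
  obtain ⟨c, hc⟩ := hy
  have h2 : c = imagePt C π Q := by
    rw [← pr₂_diag C c, hc, pr₂_fibreIncl]
  rw [← hc, h2]

/-! ### The local computation at `z_Q` -/

variable {C π Q}

/-- `h_a / g` is regular at `z_Q` for `a` regular at `c_Q` and `g` a (radical) local equation of `Δ`
at `z_Q`. [folklore] -/
theorem isRegularAt_diffFn_div (c : (diagonalDivisor C).ι) (hz : diagPt C π Q ∈ c.W)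
    {a : C.left.functionField} (ha : IsRegularAt (imagePt C π Q) a) :
    IsRegularAt (diagPt C π Q) (diffFn C a / c.fn) := by
  refine c.isRegularAt_div_fn hz (isRegularAt_diffFn (by rwa [pr₁_diag]) (by rwa [pr₂_diag])) ?_
  intro w _ _ hwU
  have hwΔ : w ∈ diagonalSet C := by by_contra h'; exact hwU h'
  obtain ⟨c', rfl⟩ := hwΔ
  exact not_isUnitAt_diffFn_diag a c'

/-- The local equation of `Δ` is not a unit at `z_Q`. [folklore] -/
theorem not_isUnitAt_fn_diagPt (c : (diagonalDivisor C).ι) (hz : diagPt C π Q ∈ c.W) :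
    ¬ IsUnitAt (diagPt C π Q) c.fn := fun h ↦
  ((c.isUnitAt_iff hz).1 h) ⟨imagePt C π Q, rfl⟩

/-- The local equation of `Δ` is regular at `z_Q`. [folklore] -/
theorem isRegularAt_fn_diagPt (c : (diagonalDivisor C).ι) (hz : diagPt C π Q ∈ c.W) :
    IsRegularAt (diagPt C π Q) c.fn :=
  isEffective_diagonalDivisor C c _ hz

end Fibre

/-! ### Pulling `h_a` back to the fibre gives `k_a = pr^♯ a − a(Q)` -/

section KeyIdentity

open FieldPoint

variable (C : SchemeOver K) [IsIntegral C.left] [SmoothOfRelativeDimension 1 C.hom] [IsProper C.hom]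
  [GeometricallyIntegral C.hom] {L : Type u} [Field L] (π : Spec (.of L) ⟶ Spec (.of K))
  (Q : Over.mk π ⟶ C)

/-- `Spec L → Spec K` is surjective. [folklore] -/
instance surjective_π : Surjective π :=
  ⟨Function.surjective_to_subsingleton (α := Spec (.of L)) (β := Spec (.of K)) _⟩

/-- `C_L → C` is surjective. [folklore] -/
instance surjective_fieldPointFst : Surjective (fieldPointFst C π) :=
  MorphismProperty.pullback_fst (P := @Surjective) _ _ inferInstance

/-- `C_L → Spec L` is surjective. [folklore] -/
instance surjective_fieldPointStr : Surjective (fieldPointStr C π) :=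
  ⟨fun _ ↦ ⟨genericPoint (C ⊗ Over.mk π).left, Subsingleton.elim _ _⟩⟩

/-- `Spec L` is integral (also in the form `(Over.mk π).left`). [folklore] -/
instance isIntegral_mk_left : IsIntegral (Over.mk π).left := inferInstanceAs (IsIntegral (Spec (.of L)))

/-- The constant rational function `l` on `Spec L`: the germ of `l ∈ Γ(Spec L, 𝒪) ≅ L` is
`(stalkClosedPointIso L)⁻¹ l`. [folklore] -/
theorem germ_top_ΓSpecIso_inv (l : L) :
    (Spec (.of L)).presheaf.germ ⊤ (closedPoint (CommRingCat.of L)) trivial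
        ((Scheme.ΓSpecIso (.of L)).inv l) =
      (stalkClosedPointIso (.of L)).inv l := by
  have h := ConcreteCategory.congr_hom (ΓSpecIso_hom_stalkClosedPointIso_inv (CommRingCat.of L))
    ((Scheme.ΓSpecIso (.of L)).inv l)
  rw [CommRingCat.comp_apply] at h
  have e : (Scheme.ΓSpecIso (.of L)).hom ((Scheme.ΓSpecIso (.of L)).inv l) = l :=
    ConcreteCategory.congr_hom (Scheme.ΓSpecIso (.of L)).inv_hom_id l
  rw [e] at h
  exact h.symm

variable {U : C.left.Opens}

omit [SmoothOfRelativeDimension 1 C.hom] [IsProper C.hom] in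
/-- The generic point of `C_L` lies in the chart `pr⁻¹U` of any open `U ∋ c_Q`. [folklore] -/
theorem genericPoint_mem_preimage (hQU : imagePt C π Q ∈ U) :
    genericPoint (C ⊗ Over.mk π).left ∈ fieldPointFst C π ⁻¹ᵁ U := by
  change fieldPointFst C π (genericPoint (C ⊗ Over.mk π).left) ∈ U
  rw [genericPoint_eq_of_isDominant]
  exact genericPoint_mem_of_mem hQU

omit [SmoothOfRelativeDimension 1 C.hom] [IsProper C.hom] [GeometricallyIntegral C.hom] in
/-- `pullbackFn` along the `L`-valued point `Q` of `a ∈ Γ(U, 𝒪_C)` is the constant `a(Q)`. [folklore] -/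
theorem pullbackFn_Q_ofSection (hQU : imagePt C π Q ∈ U) (a₀ : Γ(C.left, U)) :
    pullbackFn Q.left (ofSection (genericPoint_mem_of_mem hQU) a₀) =
      toFunctionField (X := Spec (.of L)) (closedPoint (CommRingCat.of L))
        ((stalkClosedPointIso (.of L)).inv (evalAtFieldPoint Q.left U hQU a₀)) := by
  rw [ofSection_eq_toFunctionField hQU a₀, pullbackFn_toFunctionField]
  congr 1
  rw [evalAtFieldPoint_apply]
  change _ = (stalkClosedPointIso (CommRingCat.of L)).inv
    ((stalkClosedPointIso (CommRingCat.of L)).hom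
      (Q.left.stalkMap (closedPoint L) (C.left.presheaf.germ U _ hQU a₀)))
  exact (Iso.hom_inv_id_apply (stalkClosedPointIso (CommRingCat.of L)) _).symm

omit [SmoothOfRelativeDimension 1 C.hom] [IsProper C.hom] in
/-- The constant `l` pulled back to `K(C_L)` is the rational function of `strMap l`. [folklore] -/
theorem pullbackFn_str_const (hQU : imagePt C π Q ∈ U) (l : L) :
    pullbackFn (fieldPointStr C π) (toFunctionField (X := Spec (.of L)) (closedPoint (CommRingCat.of L))
        ((stalkClosedPointIso (.of L)).inv l)) =
      ofSection (genericPoint_mem_preimage C π Q hQU) (strMap C π U l) := by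
  have hgen : genericPoint (Spec (.of L)) ∈ (⊤ : (Spec (.of L)).Opens) := trivial
  have e1 : toFunctionField (X := Spec (.of L)) (closedPoint (CommRingCat.of L))
      ((stalkClosedPointIso (.of L)).inv l) = ofSection hgen ((Scheme.ΓSpecIso (.of L)).inv l) := by
    rw [← germ_top_ΓSpecIso_inv]
    exact (ofSection_eq_toFunctionField (X := Spec (.of L)) (U := ⊤)
      (x := closedPoint (CommRingCat.of L)) trivial _).symm
  rw [e1, pullbackFn_eq_functionFieldMap, functionFieldMap_ofSection]
  change ofSection _ ((fieldPointStr C π).app ⊤ ((Scheme.ΓSpecIso (.of L)).inv l)) =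
    ofSection _ ((C ⊗ Over.mk π).left.presheaf.map (homOfLE le_top).op
      ((fieldPointStr C π).app ⊤ ((Scheme.ΓSpecIso (.of L)).inv l)))
  rw [ofSection_map]
  rfl

/-- **Key identity**: pulling `h_a = pr₁^♯ a − pr₂^♯ a` back along `C × {Q} ↪ C × C` gives
`k_a = pr^♯ a − a(Q)` (`FieldPoint.kFun`). [folklore] -/
theorem pullbackFn_fibreIncl_diffFn (hQU : imagePt C π Q ∈ U) (a₀ : Γ(C.left, U)) :
    pullbackFn (fibreIncl C π Q) (diffFn C (ofSection (genericPoint_mem_of_mem hQU) a₀)) =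
      ofSection (genericPoint_mem_preimage C π Q hQU) (kFun C π Q hQU a₀) := by
  set a := ofSection (genericPoint_mem_of_mem hQU) a₀ with ha
  have haQ : IsRegularAt (imagePt C π Q) a := isRegularAt_ofSection hQU a₀
  set η := genericPoint (C ⊗ Over.mk π).left
  -- regularity of the two terms at `fibreIncl η`
  have hgen₁ : IsRegularAt (pr₁ C (fibreIncl C π Q η)) a := by
    rw [pr₁_fibreIncl]
    exact (isRegularAt_genericPoint a).of_specializes (specializes_genericPoint (fieldPointFst C π))
  have h₁ : IsRegularAt (fibreIncl C π Q η) (functionFieldMap (pr₁ C) a) := hgen₁.functionFieldMap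
  have hreg : IsRegularAt (pr₂ C (fibreIncl C π Q η)) a := by rw [pr₂_fibreIncl]; exact haQ
  have h₂ : IsRegularAt (fibreIncl C π Q η) (functionFieldMap (pr₂ C) a) := hreg.functionFieldMap
  rw [diffFn, pullbackFn_sub _ h₁ h₂]
  -- first term
  have t₁ : pullbackFn (fibreIncl C π Q) (functionFieldMap (pr₁ C) a) =
      ofSection (genericPoint_mem_preimage C π Q hQU)
        ((fieldPointFst C π).appLE U (fieldPointFst C π ⁻¹ᵁ U) le_rfl a₀) := by
    rw [← pullbackFn_eq_functionFieldMap, ← pullbackFn_comp (pr₁ C) (fibreIncl C π Q) hgen₁,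
      fibreIncl_pr₁, pullbackFn_eq_functionFieldMap, ha, functionFieldMap_ofSection,
      ← Scheme.Hom.app_eq_appLE]
  -- second term
  have t₂ : pullbackFn (fibreIncl C π Q) (functionFieldMap (pr₂ C) a) =
      ofSection (genericPoint_mem_preimage C π Q hQU)
        (strMap C π U (evalAtFieldPoint Q.left U hQU a₀)) := by
    rw [← pullbackFn_eq_functionFieldMap, ← pullbackFn_comp (pr₂ C) (fibreIncl C π Q) hreg,
      fibreIncl_pr₂]
    have hreg' : IsRegularAt (Q.left (fieldPointStr C π η)) a := by
      rw [Subsingleton.elim (fieldPointStr C π η) (closedPoint L)]; exact haQ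
    refine (pullbackFn_comp Q.left (fieldPointStr C π) hreg').trans ?_
    rw [ha, pullbackFn_Q_ofSection C π Q hQU a₀]
    exact pullbackFn_str_const C π Q hQU _
  rw [t₁, t₂, ← map_sub]
  rfl

end KeyIdentity

/-! ### The fibre divisor `Δ|_{C × {Q}}` and its orders -/

section FibreDivisor

open FieldPoint

variable (C : SchemeOver K) [IsIntegral C.left] [SmoothOfRelativeDimension 1 C.hom] [IsProper C.hom]
  [GeometricallyIntegral C.hom] {L : Type u} [Field L] (π : Spec (.of L) ⟶ Spec (.of K))
  (Q : Over.mk π ⟶ C)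

/-- `C_L` is locally noetherian (in the form `(C ⊗ Spec L).left`). [folklore] -/
instance isLocallyNoetherian_tensor_mk_left : IsLocallyNoetherian (C ⊗ Over.mk π).left := by
  haveI : LocallyOfFiniteType (fieldPointStr C π) :=
    MorphismProperty.pullback_snd (P := @LocallyOfFiniteType) _ _ inferInstance
  exact LocallyOfFiniteType.isLocallyNoetherian (fieldPointStr C π)

/-- A product of regular functions which is a unit has unit factors. [folklore] -/
theorem _root_.Literature.AlgebraicGeometry.Motives.RatFn.IsUnitAt.of_mul_right {X : Scheme.{u}}
    [IsIntegral X] {x : X} {f g : X.functionField} (hf : IsRegularAt x f) (hg : IsRegularAt x g)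
    (h : IsUnitAt x (f * g)) : IsUnitAt x g := by
  obtain ⟨a, rfl⟩ := hf
  obtain ⟨b, rfl⟩ := hg
  rw [← map_mul, isUnitAt_toFunctionField_iff] at h
  exact (isUnitAt_toFunctionField_iff b).2 (IsUnit.mul_iff.mp h).2

variable {C π Q}

/-- **The points of the fibre on the diagonal are the rational point**: if `fibreIncl y ∈ Δ` then
`y = (Q, *)`. Proof: `fibreIncl y = z_Q`; if `y ≠ pt`, some `k_a` is a unit at `y`
(`FieldPoint.exists_isUnit_germ_kFun`), but `k_a = fibreIncl^*(h_a/g) · fibreIncl^*(g)` with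
`fibreIncl^* g` a non-unit at `y` (`g(z_Q) = 0`). [folklore] -/
theorem eq_ratPtPoint_of_fibreIncl_mem {y : (C ⊗ Over.mk π).left}
    (hy : fibreIncl C π Q y ∈ diagonalSet C) : y = ratPtPoint C π Q := by
  classical
  by_contra hne
  have hyz : fibreIncl C π Q y = diagPt C π Q := fibreIncl_eq_diagPt C π Q hy
  -- an affine open `U ∋ c_Q` and the chart `pr⁻¹U ∋ y`
  obtain ⟨U, hU, hQU, -⟩ := exists_isAffineOpen_mem_and_subset (X := C.left) (x := imagePt C π Q)
    (U := ⊤) trivial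
  have hyU : y ∈ fieldPointFst C π ⁻¹ᵁ U := by
    change fieldPointFst C π y ∈ U
    rw [← pr₁_fibreIncl, hyz, pr₁_diag]; exact hQU
  -- a chart of `Δ` at `z_Q`
  obtain ⟨c, hc⟩ := (diagonalDivisor C).covers (diagPt C π Q)
  have hgreg : IsRegularAt (diagPt C π Q) c.fn := isRegularAt_fn_diagPt c hc
  have hgreg' : IsRegularAt (fibreIncl C π Q y) c.fn := by rw [hyz]; exact hgreg
  have hgnu : ¬ IsUnitAt y (pullbackFn (fibreIncl C π Q) c.fn) := fun h ↦ by
    have hu := hgreg'.isUnitAt_of_pullbackFn h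
    rw [hyz] at hu
    exact not_isUnitAt_fn_diagPt c hc hu
  -- a unit `k_a` at `y`
  obtain ⟨a₀, ha₀⟩ := exists_isUnit_germ_kFun C π Q hU hQU ⟨y, hyU⟩ hne
  have hk : IsUnitAt y (ofSection (genericPoint_mem_preimage C π Q hQU) (kFun C π Q hQU a₀)) := by
    rw [ofSection_eq_toFunctionField hyU]
    exact (isUnitAt_toFunctionField_iff _).2 ha₀
  rw [← pullbackFn_fibreIncl_diffFn C π Q hQU a₀] at hk
  -- `h_a = (h_a / g) · g`
  set a := ofSection (genericPoint_mem_of_mem hQU) a₀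
  set q := diffFn C a / c.fn
  have hq : IsRegularAt (diagPt C π Q) q := isRegularAt_diffFn_div c hc (isRegularAt_ofSection hQU a₀)
  have e : diffFn C a = q * c.fn := (div_mul_cancel₀ _ c.ne_zero).symm
  have hspec : fibreIncl C π Q (genericPoint (C ⊗ Over.mk π).left) ⤳ diagPt C π Q := by
    rw [← hyz]; exact ((genericPoint_spec _).specializes (Set.mem_univ y)).map (fibreIncl C π Q).continuous
  rw [e, pullbackFn_mul _ (hq.of_specializes hspec) (hgreg.of_specializes hspec)] at hk
  have hq' : IsRegularAt (fibreIncl C π Q y) q := by rw [hyz]; exact hq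
  exact hgnu (IsUnitAt.of_mul_right hq'.pullbackFn hgreg'.pullbackFn hk)

variable (C π Q)

omit [IsIntegral C.left] in
/-- The rational point is not the generic point of the curve `C_L`. [folklore] -/
theorem ratPtPoint_ne_genericPoint : ratPtPoint C π Q ≠ genericPoint (C ⊗ Over.mk π).left := by
  intro h
  haveI : IsSeparated C.hom := inferInstance
  have hcl := isClosed_ratPtPoint C π Q
  -- every point is then `pt`
  have hall : ∀ y : (C ⊗ Over.mk π).left, y = ratPtPoint C π Q := fun y ↦ by
    have : y ∈ closure {genericPoint (C ⊗ Over.mk π).left} := by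
      rw [(genericPoint_spec _).def]; trivial
    rw [← h, hcl.closure_eq] at this
    exact this
  -- but `dim C_L = 1`
  have h1 := height_top_of_smoothCurve (curveBC C π)
  have hne : ¬ IsMin (⊤ : ↥(curveBC C π).left) := by
    rw [← Order.height_eq_zero, h1]; decide
  obtain ⟨b, hb⟩ := not_isMin_iff.mp hne
  exact hb.ne ((hall b).trans (hall ⊤).symm)

/-- `Δ` avoids the image of the generic point of the fibre. [folklore] -/
theorem avoids_fibreIncl_genericPoint :
    (diagonalDivisor C).Avoids (fibreIncl C π Q (genericPoint (C ⊗ Over.mk π).left)) :=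
  (avoids_diagonalDivisor_iff C _).2 fun h ↦
    ratPtPoint_ne_genericPoint C π Q (eq_ratPtPoint_of_fibreIncl_mem h).symm

/-- **The fibre divisor `Δ|_{C × {Q}}`**: the pullback of the diagonal divisor to `C_L = C × {Q}`
(Milne, *Jacobian Varieties*, Example 3.12: the fibre of the canonical divisor over a point). [cite: Milne1986JacobianVarieties, §3 Example 3.12] -/
def diagonalFibre : CartierDivisor (C ⊗ Over.mk π).left :=
  (diagonalDivisor C).pullbackAvoiding (fibreIncl C π Q) (avoids_fibreIncl_genericPoint C π Q)

/-- The local ring of `C_L` at the rational point is a discrete valuation ring. [folklore] -/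
instance isDiscreteValuationRing_stalk_ratPtPoint :
    IsDiscreteValuationRing ((C ⊗ Over.mk π).left.presheaf.stalk (ratPtPoint C π Q)) :=
  isDiscreteValuationRing_stalk (curveBC C π) (ratPtPoint_ne_genericPoint C π Q)

/-- **Multiplicity one**: the pulled-back local equation of `Δ` has order one at the rational point.
Proof: its germ `ĝ₀` divides the germs of all `k_a` (key identity and `h_a/g ∈ 𝒪_{z_Q}`), which
generate the maximal ideal (`FieldPoint.span_germ_kFun_eq_maximalIdeal`); so `𝔪 = (ĝ₀)` and `ĝ₀` is
a uniformizer. [folklore] -/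
theorem ord_pullbackFn_fn_ratPtPoint (c : (diagonalDivisor C).ι) (hc : diagPt C π Q ∈ c.W) :
    Scheme.ord (pullbackFn (fibreIncl C π Q) c.fn) (ratPtPoint C π Q) = 1 := by
  classical
  have hyz : fibreIncl C π Q (ratPtPoint C π Q) = diagPt C π Q := fibreIncl_ratPtPoint C π Q
  obtain ⟨U, hU, hQU, -⟩ := exists_isAffineOpen_mem_and_subset (X := C.left) (x := imagePt C π Q)
    (U := ⊤) trivial
  have hgreg : IsRegularAt (diagPt C π Q) c.fn := isRegularAt_fn_diagPt c hc
  have hspec : fibreIncl C π Q (genericPoint (C ⊗ Over.mk π).left) ⤳ diagPt C π Q := by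
    rw [← hyz]
    exact ((genericPoint_spec _).specializes (Set.mem_univ _)).map (fibreIncl C π Q).continuous
  -- the germ `g₀` of the pulled-back local equation at `pt`
  have hgreg' : IsRegularAt (fibreIncl C π Q (ratPtPoint C π Q)) c.fn := by rw [hyz]; exact hgreg
  obtain ⟨g₀, hg₀⟩ := hgreg'.pullbackFn (g := fibreIncl C π Q) (y := ratPtPoint C π Q)
  have hne0 : pullbackFn (fibreIncl C π Q) c.fn ≠ 0 :=
    pullbackFn_ne_zero _ (avoids_fibreIncl_genericPoint C π Q c (hspec.mem_open c.W.2 hc))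
  have hg₀0 : g₀ ≠ 0 := fun h ↦ hne0 (by rw [← hg₀, h, map_zero])
  have hg₀nu : ¬ IsUnit g₀ := fun h ↦ by
    have hu := hgreg'.isUnitAt_of_pullbackFn ⟨h.unit, hg₀⟩
    rw [hyz] at hu
    exact not_isUnitAt_fn_diagPt c hc hu
  -- `g₀` divides the germs of all `k_a`
  have hdiv : ∀ a₀ : Γ(C.left, U),
      (C ⊗ Over.mk π).left.presheaf.germ (fieldPointFst C π ⁻¹ᵁ U) (ratPtPoint C π Q)
        (ratPtPoint_mem C π Q hQU) (kFun C π Q hQU a₀) ∈ Ideal.span {g₀} := by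
    intro a₀
    set a := ofSection (genericPoint_mem_of_mem hQU) a₀
    set q := diffFn C a / c.fn
    have hq : IsRegularAt (diagPt C π Q) q := isRegularAt_diffFn_div c hc (isRegularAt_ofSection hQU a₀)
    have hq' : IsRegularAt (fibreIncl C π Q (ratPtPoint C π Q)) q := by rw [hyz]; exact hq
    obtain ⟨q₀, hq₀⟩ := hq'.pullbackFn (g := fibreIncl C π Q) (y := ratPtPoint C π Q)
    have e : diffFn C a = q * c.fn := (div_mul_cancel₀ _ c.ne_zero).symm
    have key := pullbackFn_fibreIncl_diffFn C π Q hQU a₀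
    rw [e, pullbackFn_mul _ (hq.of_specializes hspec) (hgreg.of_specializes hspec), ← hq₀, ← hg₀,
      ← map_mul, ofSection_eq_toFunctionField (ratPtPoint_mem C π Q hQU)] at key
    rw [← toFunctionField_injective _ key]
    exact Ideal.mem_span_singleton'.2 ⟨q₀, rfl⟩
  -- hence `𝔪 = (g₀)` and `g₀` is a uniformizer
  have hmax : maximalIdeal ((C ⊗ Over.mk π).left.presheaf.stalk (ratPtPoint C π Q)) = Ideal.span {g₀} := by
    apply le_antisymm
    · have h := span_germ_kFun_eq_maximalIdeal C π Q hU hQU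
      change Ideal.span _ = maximalIdeal ((C ⊗ Over.mk π).left.presheaf.stalk (ratPtPoint C π Q)) at h
      rw [← h, Ideal.span_le]
      rintro _ ⟨a₀, rfl⟩
      exact hdiv a₀
    · rw [Ideal.span_le, Set.singleton_subset_iff]
      exact hg₀nu
  have hirr : Irreducible g₀ := IsDiscreteValuationRing.irreducible_of_span_eq_maximalIdeal g₀ hg₀0 hmax
  rw [← hg₀, ord_toFunctionField_eq_addVal hg₀0, IsDiscreteValuationRing.addVal_uniformizer hirr]
  rfl

open Classical in
/-- **`ord_y (Δ|_{C × {Q}}) = δ_{y, pt}`**: the fibre divisor is the reduced point divisor of the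
rational point (Milne, *Jacobian Varieties*, Example 3.12: the fibre of `D` over `P` is `P`, with
multiplicity one). [cite: Milne1986JacobianVarieties, §3 Example 3.12] -/
theorem ordAt_diagonalFibre (y : (C ⊗ Over.mk π).left) :
    (diagonalFibre C π Q).ordAt y = if y = ratPtPoint C π Q then 1 else 0 := by
  split_ifs with h
  · subst h
    obtain ⟨c, hc⟩ := (diagonalDivisor C).covers (diagPt C π Q)
    have hyz := fibreIncl_ratPtPoint C π Q
    have hspec : fibreIncl C π Q (genericPoint (C ⊗ Over.mk π).left) ⤳ diagPt C π Q := by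
      rw [← hyz]
      exact ((genericPoint_spec _).specializes (Set.mem_univ _)).map (fibreIncl C π Q).continuous
    have hη : fibreIncl C π Q (genericPoint (C ⊗ Over.mk π).left) ∈ c.W := hspec.mem_open c.W.2 hc
    have hmem : ratPtPoint C π Q ∈ (diagonalFibre C π Q).U ⟨c, hη⟩ := by
      change fibreIncl C π Q (ratPtPoint C π Q) ∈ c.W; rw [hyz]; exact hc
    rw [(diagonalFibre C π Q).ordAt_eq_ord hmem]
    exact ord_pullbackFn_fn_ratPtPoint C π Q c hc
  · have hyΔ : fibreIncl C π Q y ∉ diagonalSet C := fun hy ↦ h (eq_ratPtPoint_of_fibreIncl_mem hy)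
    obtain ⟨i, hi⟩ := (diagonalFibre C π Q).covers y
    rw [(diagonalFibre C π Q).ordAt_eq_ord hi]
    exact (((avoids_diagonalDivisor_iff C _).2 hyΔ) i.1 hi).pullbackFn.ord_eq_zero

/-- The fibre divisor and the point divisor `[pt]` of `C_L` have the same orders everywhere. [folklore] -/
theorem ordAt_diagonalFibre_eq_ordAt_pointDivisor (y : (C ⊗ Over.mk π).left) :
    (diagonalFibre C π Q).ordAt y =
      (pointDivisor (curveBC C π) (ratPtPoint_ne_genericPoint C π Q)).ordAt y := by
  classical
  rw [ordAt_diagonalFibre]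
  exact (ordAt_pointDivisor (C := curveBC C π) (ratPtPoint_ne_genericPoint C π Q) y).symm

/-- **`toDivisor (Δ|_{C × {Q}}) = place(pt)`** in `Div(L(C_L)/L)`: the fibre divisor is the prime
divisor of the rational point, as a divisor of the function field. [cite: Milne1986JacobianVarieties, §3 Example 3.12] -/
theorem toDivisor_diagonalFibre :
    toDivisor (curveBC C π) (diagonalFibre C π Q) =
      Finsupp.single (place (curveBC C π) (ratPtPoint C π Q) (ratPtPoint_ne_genericPoint C π Q)) 1 := by
  rw [← toDivisor_pointDivisor]
  ext v
  rw [toDivisor_apply, toDivisor_apply]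
  exact ordAt_diagonalFibre_eq_ordAt_pointDivisor C π Q _

/-- The fibre divisor is effective. [folklore] -/
theorem isEffective_diagonalFibre : (diagonalFibre C π Q).IsEffective := by
  rintro ⟨i, hi⟩ y hy
  exact ((isEffective_diagonalDivisor C) i _ hy).pullbackFn

/-- **The divisor-class pullback of `Δ` to the fibre is linearly equivalent to `[pt]`**:
`classPullback Δ (fibreIncl) ∼ Δ|_{C × {Q}}` (the class pullback moves `Δ` away first;
`LinEquiv.pullbackAvoiding`). [folklore] -/
theorem diagonalFibre_linEquiv_classPullback :
    (diagonalFibre C π Q).LinEquiv ((diagonalDivisor C).classPullback (fibreIncl C π Q)) :=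
  CartierDivisor.LinEquiv.pullbackAvoiding (fibreIncl C π Q)
    (CartierDivisor.linEquiv_moveAway (diagonalDivisor C) _) (avoids_fibreIncl_genericPoint C π Q)
    (CartierDivisor.moveAway_avoids _ _)

end FibreDivisor

end CurvePlaces

end Literature.AlgebraicGeometry.Motives
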